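import Summits.AtomisticToContinuum.HydrodynamicLimit.Theorems.OneFlightGossipEngineEnergyCurrentTailsPedigreeOrders
import Summits.AtomisticToContinuum.HydrodynamicLimit.Theorems.OneFlightGossipEngineEnergyCurrentTailsPedigreeAssembly
import HarnessLib

/-!
# Order-4 census assembly of the line `pedigree-perpetuity`
# (crux `EnergyCurrentTails`, stmt-AtomisticToContinuum-9235)

Registered helper `censusDecay_of_mergeIntakeTailsOrder_four : LineageLedger → LevelInclusion →
InitialEnergyTails → NeutralRunTails → MergeIntakeTailsOrder 4 → CensusDecay` (lead c3; this file by
the lead's c3 worker): the ORDER-4 VARIANT of the landed census assembly `stub_censusAssembly` of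
`…Theorems.OneFlightGossipEngineEnergyCurrentTailsPedigreeAssembly`, closing the loop with the cycle-1
finding of the line that the merge-intake stub is census-strength (`…PedigreeCircularity`:
`CensusDecayOrder p → MergeIntakeTailsOrder p`).  The landed assembly consumes the merge hypothesis
only through the price `B₁⁺/⌊L/3⌋⁵` of the channel `{⌊L/3⌋Θ₀ ≤ Λ}` and the final arithmetic of
`census_constants`; with the order-4 hypothesis the price is `B₁⁺/⌊L/3⌋⁴ ≤ 9⁴ B₁⁺/L⁴`
(`L ≤ 9⌊L/3⌋` for `L ≥ 3`), still of census order `L⁻⁴`.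

## Contents

* `census_constants_four` — the constants lemma with the merge term at the fourth power, derived from
  `census_constants` at `B₁ = 0` plus the bound `B₁⁺/⌊L/3⌋⁴ ≤ 9⁴ B₁⁺/L⁴`;
* `censusDecay_of_mergeIntakeTailsOrder_four` — the landed proof of `stub_censusAssembly` verbatim
  (frame, small levels, time zero by Markov, positive times by the cover of `LevelInclusion` off the two
  null events and the union bound `sum_measure_le_of_cover`), with `census_constants_four` and the
  fourth power in the merge channel.
-/

noncomputable section

open MeasureTheory Set Filter
open scoped ENNReal InnerProductSpace BigOperators

namespace Summit.AtomisticToContinuum.HydrodynamicLimit.Theorems.EnergyCurrentTailsPedigree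

open Literature.MathematicalPhysics.KineticTheory Literature.Analysis.FluidPDE

/-- **The constants of the order-4 census assembly**: `census_constants` with the merge price
`B₁ L⁻⁵` replaced by `B₁ L⁻⁴`.  Same level threshold `L₀ ≥ 3`; the constant is the one of
`census_constants` at `B₁ = 0` plus `9⁴ B₁⁺` (from `L ≤ 9 ⌊L/3⌋` for `L ≥ 3`, `third_level`). -/
theorem census_constants_four {δ Θ₀ Θs Cr ρ₁ Cd : ℝ} (hδ : 0 < δ) (hδ1 : δ < 1) (hΘ₀ : 0 < Θ₀)
    (hΘs : 0 < Θs) (hCr : 0 ≤ Cr) (hρ0 : 0 ≤ ρ₁) (hρ1 : ρ₁ < 1) (hCd : 0 ≤ Cd) (B₁ Θe : ℝ) :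
    ∃ L₀ : ℝ, 3 ≤ L₀ ∧ ∃ B : ℝ, 0 ≤ B ∧
      (∀ L : ℕ, 1 ≤ L → (L : ℝ) ≤ L₀ → ∀ n : ℝ, 0 ≤ n → n ≤ B * n / (L : ℝ) ^ 4) ∧
      (∀ L : ℕ, 1 ≤ L → ∀ n : ℝ, 0 ≤ n →
        Cd * n * Real.exp (-((L : ℝ) * Θ₀) / Θs) / ((L : ℝ) * Θ₀) ≤ B * n / (L : ℝ) ^ 4) ∧
      (∀ L : ℕ, L₀ ≤ (L : ℝ) → 3 * Θe ≤ (L : ℝ) * Θ₀ ∧ ∃ m : ℕ,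
        (∀ g₁ : ℕ, Θ₀ * (∑ g ∈ Finset.range g₁, (1 - δ) ^ g * ((m + g + 2 : ℕ) : ℝ))
            ≤ (L : ℝ) * Θ₀ / 3) ∧
        ∀ n : ℝ, 0 ≤ n →
          n * (Cr * ρ₁ ^ (m + 2) / (1 - ρ₁) + max B₁ 0 / ((L / 3 : ℕ) : ℝ) ^ 4
              + Real.exp (-((L : ℝ) * Θ₀) / Θs))
            + Cd * n * Real.exp (-((L : ℝ) * Θ₀ / 3) / Θs) / ((L : ℝ) * Θ₀ / 3)
            ≤ B * n / (L : ℝ) ^ 4) := by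
  obtain ⟨L₀, hL₀3, B, hB, Hsmall, Hzero, Hpos⟩ :=
    census_constants hδ hδ1 hΘ₀ hΘs hCr hρ0 hρ1 hCd 0 Θe
  have hB₁ : 0 ≤ max B₁ 0 := le_max_right _ _
  have hmono : ∀ (L : ℕ) (n : ℝ), 0 ≤ n →
      B * n / (L : ℝ) ^ 4 ≤ (B + max B₁ 0 * 9 ^ 4) * n / (L : ℝ) ^ 4 := fun L n hn =>
    div_le_div_of_nonneg_right (mul_le_mul_of_nonneg_right (by nlinarith) hn) (by positivity)
  refine ⟨L₀, hL₀3, B + max B₁ 0 * 9 ^ 4, by positivity,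
    fun L hL hLL n hn => (Hsmall L hL hLL n hn).trans (hmono L n hn),
    fun L hL n hn => (Hzero L hL n hn).trans (hmono L n hn), fun L hLL => ?_⟩
  obtain ⟨h3Θe, m, hallow, Hbound⟩ := Hpos L hLL
  refine ⟨h3Θe, m, hallow, fun n hn => ?_⟩
  have hL3 : (3 : ℝ) ≤ L := hL₀3.trans hLL
  have hLpos : (0 : ℝ) < L := by linarith
  have hLnat : 3 ≤ L := by exact_mod_cast hL3
  obtain ⟨hq1, -, hq3⟩ := third_level hLnat
  have hq0 : (0 : ℝ) < ((L / 3 : ℕ) : ℝ) := by exact_mod_cast hq1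
  have hPΛ : max B₁ 0 / ((L / 3 : ℕ) : ℝ) ^ 4 ≤ max B₁ 0 * 9 ^ 4 / (L : ℝ) ^ 4 := by
    have h4 : (L : ℝ) ^ 4 ≤ (9 * ((L / 3 : ℕ) : ℝ)) ^ 4 := pow_le_pow_left₀ hLpos.le hq3 4
    calc max B₁ 0 / ((L / 3 : ℕ) : ℝ) ^ 4 = max B₁ 0 * 9 ^ 4 / (9 * ((L / 3 : ℕ) : ℝ)) ^ 4 := by
          field_simp
      _ ≤ max B₁ 0 * 9 ^ 4 / (L : ℝ) ^ 4 :=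
          div_le_div_of_nonneg_left (by positivity) (by positivity) h4
  have hB0 := Hbound n hn
  simp only [max_self, zero_div, add_zero] at hB0
  calc n * (Cr * ρ₁ ^ (m + 2) / (1 - ρ₁) + max B₁ 0 / ((L / 3 : ℕ) : ℝ) ^ 4
            + Real.exp (-((L : ℝ) * Θ₀) / Θs))
          + Cd * n * Real.exp (-((L : ℝ) * Θ₀ / 3) / Θs) / ((L : ℝ) * Θ₀ / 3)
      = (n * (Cr * ρ₁ ^ (m + 2) / (1 - ρ₁) + Real.exp (-((L : ℝ) * Θ₀) / Θs))
          + Cd * n * Real.exp (-((L : ℝ) * Θ₀ / 3) / Θs) / ((L : ℝ) * Θ₀ / 3))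
          + n * (max B₁ 0 / ((L / 3 : ℕ) : ℝ) ^ 4) := by ring
    _ ≤ B * n / (L : ℝ) ^ 4 + n * (max B₁ 0 * 9 ^ 4 / (L : ℝ) ^ 4) :=
        add_le_add hB0 (mul_le_mul_of_nonneg_left hPΛ hn)
    _ = (B + max B₁ 0 * 9 ^ 4) * n / (L : ℝ) ^ 4 := by ring

/-- **Registered helper `censusDecay_of_mergeIntakeTailsOrder_four`** (line `pedigree-perpetuity`,
lead c3; order-4 variant of `stub_censusAssembly`): the lineage ledger, the sure level inclusion, the
Gaussian facts of the data, the annealed run price and the ORDER-4 merge-intake tail bound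
`P(Λ ≥ LΘ₀) ≤ B₁ L⁻⁴` already give the census decay `C⁺` (which is itself of order 4).  Same proof as
`stub_censusAssembly`, the merge channel now priced `B₁⁺/⌊L/3⌋⁴ ≤ 9⁴ B₁⁺ / L⁴`
(`census_constants_four`). -/
theorem censusDecay_of_mergeIntakeTailsOrder_four : LineageLedger → LevelInclusion → InitialEnergyTails → NeutralRunTails → MergeIntakeTailsOrder 4 → CensusDecay := by
  rintro ⟨hSure, hMeas⟩ hIncl hData hRuns hMerges a₀ θ₀ u₀ ha hθ hu ha0 hθ0
  obtain ⟨Θs, hΘs, eb, heb, Cd, hCd, HD⟩ := hData a₀ θ₀ u₀ ha hθ hu ha0 hθ0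
  obtain ⟨σr, hσr, HR⟩ := hRuns a₀ θ₀ u₀ ha hθ hu ha0 hθ0
  obtain ⟨σm, hσm, HM⟩ := hMerges a₀ θ₀ u₀ ha hθ hu ha0 hθ0
  refine ⟨min (min σr σm) (1 / 2), lt_min (lt_min hσr hσm) (by norm_num), ?_⟩
  intro σ hσ hσlt T ρ θ u hE Φ h0 t ht
  have hσr' : σ < σr := lt_of_lt_of_le hσlt ((min_le_left _ _).trans (min_le_left _ _))
  have hσm' : σ < σm := lt_of_lt_of_le hσlt ((min_le_left _ _).trans (min_le_right _ _))
  have hσ2 : σ ≤ 1 / 2 := (lt_of_lt_of_le hσlt (min_le_right _ _)).le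
  obtain ⟨δ, hδ, hδ1, Θe, Cr, hCr, ρ₁, hρ0, hρ1, Nr, HR'⟩ := HR σ hσ hσr' T ρ θ u hE Φ h0 t ht
  obtain ⟨Θ₀, hΘ₀, B₁, Nm, HM'⟩ := HM σ hσ hσm' T ρ θ u hE Φ h0 t ht
  obtain ⟨L₀, hL₀3, B, hB, Hsmall, Hzero, Hpos⟩ :=
    census_constants_four hδ hδ1 hΘ₀ hΘs hCr hρ0 hρ1 hCd B₁ Θe
  refine ⟨Θ₀, hΘ₀, B, max Nr Nm, fun N hN s hs L hL => ?_⟩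
  have hNr : Nr ≤ N := le_of_max_le_left hN
  have hNm : Nm ≤ N := le_of_max_le_right hN
  haveI := isProbabilityMeasure_localGibbsLaw ha hθ hu ha0 hθ0 hσ2 N (Φ N)
  set P := localGibbsLaw σ a₀ u₀ θ₀ N (Φ N) with hP
  have hn0 : (0 : ℝ) ≤ (N : ℝ) + 1 := by positivity
  have hL1 : (1 : ℝ) ≤ (L : ℝ) := by exact_mod_cast hL
  have hx : 0 < (L : ℝ) * Θ₀ := by positivity
  have hPac : P ≪ liouville (Torus.geometry (Fin 3)) (N + 1) (hsDiameter σ N) :=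
    localGibbsLaw_absolutelyContinuous σ a₀ u₀ θ₀ N (Φ N)
  have hPgood : ∀ᵐ z ∂P, z ∈ (Φ N).good := ae_mem_good_localGibbsLaw σ a₀ u₀ θ₀ N (Φ N)
  unfold census
  by_cases hLsmall : (L : ℝ) ≤ L₀
  · -- small levels: the trivial bound
    calc ∫⁻ z, (∑ l : Fin (N + 1), Set.indicator {v : V3 | (L : ℝ) * Θ₀ ≤ ‖v‖ ^ 2}
            (fun _ => (1 : ℝ≥0∞)) (((Φ N).flow s z l).2)) ∂P
        ≤ ((N + 1 : ℕ) : ℝ≥0∞) := lintegral_levelCount_le_card (Φ N) P s _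
      _ = ENNReal.ofReal ((N : ℝ) + 1) := by
          rw [← ENNReal.ofReal_natCast]; push_cast; rfl
      _ ≤ ENNReal.ofReal (B * ((N : ℝ) + 1) / (L : ℝ) ^ 4) :=
          ENNReal.ofReal_le_ofReal (Hsmall L hL hLsmall _ hn0)
  have hL₀L : L₀ ≤ (L : ℝ) := (not_le.1 hLsmall).le
  rcases hs.1.eq_or_lt with hs0 | hs0
  · -- time zero: Markov against the data tail energy
    subst hs0
    have hdat := (HD σ hσ hσ2 N (Φ N) ((L : ℝ) * Θ₀) hx.le).2.1
    calc ∫⁻ z, (∑ l : Fin (N + 1), Set.indicator {v : V3 | (L : ℝ) * Θ₀ ≤ ‖v‖ ^ 2}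
            (fun _ => (1 : ℝ≥0∞)) (((Φ N).flow 0 z l).2)) ∂P
        ≤ ENNReal.ofReal (Cd * ((N : ℝ) + 1) * Real.exp (-((L : ℝ) * Θ₀) / Θs) / ((L : ℝ) * Θ₀)) :=
          lintegral_levelCount_zero_le (Φ N) P hPgood hx hdat
      _ ≤ ENNReal.ofReal (B * ((N : ℝ) + 1) / (L : ℝ) ^ 4) :=
          ENNReal.ofReal_le_ofReal (Hzero L hL _ hn0)
  -- positive times, large levels
  obtain ⟨h3Θe, m, hallow, Hbound⟩ := Hpos L hL₀L
  have hL3 : 3 ≤ L := by exact_mod_cast hL₀3.trans hL₀L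
  obtain ⟨hq1, hq2, -⟩ := third_level hL3
  obtain ⟨g₁, hg₁⟩ := exists_blockHorizon hδ hx (show 0 ≤ eb * ((N : ℝ) + 1) by positivity)
  -- the four channels and the two null events
  set ε := hsDiameter σ N with hε
  set A : Fin (N + 1) → Set (Config (N + 1) (Fin 3) T3) :=
    fun i => {z | (L : ℝ) * Θ₀ ≤ ‖((Φ N).flow s z i).2‖ ^ 2} with hA
  set R : Fin (N + 1) → Set (Config (N + 1) (Fin 3) T3) := fun i =>
    ⋃ g ∈ Finset.range g₁, {z | ((m + g + 2 : ℕ) : ℕ∞)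
      ≤ eblockLen ε (fun r => (Φ N).flow r z) Θe δ i s g} with hR
  set Λ : Fin (N + 1) → Set (Config (N + 1) (Fin 3) T3) := fun i =>
    {z | (L : ℝ) * Θ₀ / 3 ≤ warmIntake ε (fun r => (Φ N).flow r z) Θ₀ i s} with hΛ
  set I : Fin (N + 1) → Set (Config (N + 1) (Fin 3) T3) := fun i =>
    {z | (L : ℝ) * Θ₀ / 3 ≤ ‖(z (termCarrier ε (fun r => (Φ N).flow r z) i s)).2‖ ^ 2
      * termWeight ε (fun r => (Φ N).flow r z) i s} with hI
  set Col : Fin (N + 1) → Set (Config (N + 1) (Fin 3) T3) := fun i =>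
    {z | Participates (Torus.geometry (Fin 3)) ε ((Φ N).flow s z) i} with hCol
  set D : Set (Config (N + 1) (Fin 3) T3) :=
    {z | (L : ℝ) * Θ₀ / 3 ≤ (1 - δ) ^ g₁ * ∑ l : Fin (N + 1), ‖(z l).2‖ ^ 2} with hD
  -- prices
  have h1ρ : 0 < 1 - ρ₁ := by linarith
  have hPR : ∀ i, P (R i) ≤ ENNReal.ofReal (Cr * ρ₁ ^ (m + 2) / (1 - ρ₁)) := by
    intro i
    calc P (R i) ≤ ∑ g ∈ Finset.range g₁, P {z | ((m + g + 2 : ℕ) : ℕ∞)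
            ≤ eblockLen ε (fun r => (Φ N).flow r z) Θe δ i s g} := measure_biUnion_finset_le _ _
      _ ≤ ∑ g ∈ Finset.range g₁, ENNReal.ofReal (Cr * ρ₁ ^ (m + g + 2)) :=
          Finset.sum_le_sum fun g _ => HR' N hNr s hs i g (m + g + 2)
      _ = ENNReal.ofReal (∑ g ∈ Finset.range g₁, Cr * ρ₁ ^ (m + g + 2)) :=
          (ENNReal.ofReal_sum_of_nonneg fun g _ => by positivity).symm
      _ ≤ ENNReal.ofReal (Cr * ρ₁ ^ (m + 2) / (1 - ρ₁)) :=
          ENNReal.ofReal_le_ofReal (sum_run_price_le hCr hρ0 hρ1 m g₁)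
  have hPΛ : ∀ i, P (Λ i) ≤ ENNReal.ofReal (max B₁ 0 / ((L / 3 : ℕ) : ℝ) ^ 4) := by
    intro i
    calc P (Λ i) ≤ P {z | ((L / 3 : ℕ) : ℝ) * Θ₀
            ≤ warmIntake ε (fun r => (Φ N).flow r z) Θ₀ i s} := by
          refine measure_mono fun z hz => ?_
          refine Set.mem_setOf_eq ▸ (le_trans ?_ (Set.mem_setOf_eq ▸ hz))
          calc ((L / 3 : ℕ) : ℝ) * Θ₀ ≤ ((L : ℝ) / 3) * Θ₀ := mul_le_mul_of_nonneg_right hq2 hΘ₀.le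
            _ = (L : ℝ) * Θ₀ / 3 := by ring
      _ ≤ ENNReal.ofReal (B₁ / ((L / 3 : ℕ) : ℝ) ^ 4) := HM' N hNm s hs i (L / 3) hq1
      _ ≤ ENNReal.ofReal (max B₁ 0 / ((L / 3 : ℕ) : ℝ) ^ 4) :=
          ENNReal.ofReal_le_ofReal (div_le_div_of_nonneg_right (le_max_left _ _) (by positivity))
  have hPD : P D ≤ ENNReal.ofReal (Real.exp (-((L : ℝ) * Θ₀) / Θs)) := by
    calc P D ≤ P {z | eb * ((N : ℝ) + 1) + (L : ℝ) * Θ₀ ≤ ∑ l : Fin (N + 1), ‖(z l).2‖ ^ 2} :=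
          measure_mono fun z hz => le_of_discount_le hδ1 hg₁ hz
      _ ≤ _ := (HD σ hσ hσ2 N (Φ N) ((L : ℝ) * Θ₀) hx.le).2.2
  have hPI : (∑ i, P (I i ∩ (Φ N).good)) ≤ ENNReal.ofReal
      (Cd * ((N : ℝ) + 1) * Real.exp (-((L : ℝ) * Θ₀ / 3) / Θs) / ((L : ℝ) * Θ₀ / 3)) := by
    refine sum_measure_inheritance_le P (Φ N).good
      (fun i z => termCarrier ε (fun r => (Φ N).flow r z) i s)
      (fun i z => termWeight ε (fun r => (Φ N).flow r z) i s) (by positivity) (by positivity)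
      (Φ N).measurableSet_good (fun i => ((hMeas σ N (Φ N) i s).2.1).mono_ac hPac)
      (fun i => ((hMeas σ N (Φ N) i s).2.2).mono_ac hPac) (fun z hz i => ?_) (fun z hz j => ?_) ?_
    · exact termWeight_mem_unitInterval ε _ i s ((hSure σ N (Φ N)).1 z hz i s hs0).1
    · exact (hSure σ N (Φ N)).2 z hz s hs0 j
    · exact (HD σ hσ hσ2 N (Φ N) ((L : ℝ) * Θ₀ / 3) (by positivity)).2.1
  have hgood : P (Φ N).goodᶜ = 0 := ae_iff.1 hPgood
  have hcol : ∀ i, P (Col i) = 0 := fun i =>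
    measure_participates_flow_eq_zero (hsDiameter_pos hσ N).ne' (Φ N) P hPac s i
  -- the cover by `LevelInclusion`
  have hcover : ∀ i, ∀ z ∈ (Φ N).good, z ∉ Col i → z ∈ A i →
      z ∈ R i ∨ z ∈ Λ i ∨ z ∈ I i ∨ z ∈ D := by
    intro i z hz hzc hzA
    rcases hIncl σ N (Φ N) z hz i s hs0 hzc δ Θ₀ Θe (L : ℝ) m g₁ hδ hδ1 hΘ₀ (hallow g₁) h3Θe hzA
      with ⟨g, hg, hge⟩ | h | h | h
    · refine Or.inl ?_
      simp only [hR, Set.mem_iUnion, Finset.mem_range, exists_prop]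
      exact ⟨g, hg, hge⟩
    · exact Or.inr (Or.inl h)
    · exact Or.inr (Or.inr (Or.inl h))
    · exact Or.inr (Or.inr (Or.inr h))
  -- assemble
  rw [lintegral_levelCount_eq_sum]
  calc (∑ l : Fin (N + 1), P {z | (L : ℝ) * Θ₀ ≤ ‖((Φ N).flow s z l).2‖ ^ 2})
      ≤ ENNReal.ofReal (((N + 1 : ℕ) : ℝ) * (Cr * ρ₁ ^ (m + 2) / (1 - ρ₁)
          + max B₁ 0 / ((L / 3 : ℕ) : ℝ) ^ 4 + Real.exp (-((L : ℝ) * Θ₀) / Θs))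
          + Cd * ((N : ℝ) + 1) * Real.exp (-((L : ℝ) * Θ₀ / 3) / Θs) / ((L : ℝ) * Θ₀ / 3)) :=
        sum_measure_le_of_cover P A R Λ I Col (Φ N).good D (by positivity) (by positivity)
          (by positivity) (by positivity) hgood hcol hcover hPR hPΛ hPD hPI
    _ ≤ ENNReal.ofReal (B * ((N : ℝ) + 1) / (L : ℝ) ^ 4) := by
        refine ENNReal.ofReal_le_ofReal ?_
        push_cast
        exact Hbound _ hn0

end Summit.AtomisticToContinuum.HydrodynamicLimit.Theorems.EnergyCurrentTailsPedigree

end
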